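import Mathlib.RepresentationTheory.Basic
import Mathlib.LinearAlgebra.Span.Basic
import Mathlib.Tactic.Module
import HarnessLib

/-!
# Extensions between one-dimensional characters: the derivation, splitting, and the unipotent model («CHAR-EXT COCYCLE»)

Generic representation theory over a commutative ring `k` (any monoid `G`), Mathlib-only (`Representation k G V`),
THEOREMS ONLY (no `def`, no `instance`, no named fact).

THE SITUATION.  `ρ : Representation k G V`, two characters `χ χ' : G →* k` and a `k`-linear functional `p : V →ₗ[k] k` with
* `hquot : ∀ g v, p (ρ g v) = χ' g * p v`  — `p` is `G`-equivariant onto the character `χ'` (the QUOTIENT character), and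
* `hker  : ∀ g v, p v = 0 → ρ g v = χ g • v` — `G` acts on `ker p` by the character `χ` (the SUB character);
together with a vector `u` with `p u = 1` this is an extension `0 → ker p → V →ᵖ k_{χ'} → 0` of the character `χ'` by a
`χ`-isotypic module (`ker p` is a LINE in the applications, but §1–§3 never use that).  «SPLIT» means: there is `v₀` with
`p v₀ = 1` and `ρ g v₀ = χ' g • v₀` for all `g` (an equivariant section `1 ↦ v₀`; both `ker p` and `k v₀` are
`G`-stable, §1, and over a field `V = ker p ⊕ k v₀` is the tree's
`Literature.LinearAlgebra.Subspace.isCompl_ker_span_singleton_of_apply_eq_one`, not restated).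

* §1 (any monoid) THE DERIVATION `D_u g := ρ g u - χ' g • u`: it lies in `ker p`, satisfies the twisted Leibniz rule
  `D_u (g h) = χ g • D_u h + χ' h • D_u g` (a derivation of `G` into the `(χ, χ')`-bimodule `ker p`), changing `u` by
  `w ∈ ker p` adds the PRINCIPAL derivation `g ↦ (χ g - χ' g) • w`, and SPLIT ⟺ `D_u` is principal.
* §2 (commuting elements, DISTINCT characters) if `χ' g₀ - χ g₀` is a unit for ONE `g₀` commuting with `G`, the extension
  SPLITS (explicit `v₀`), and every equivariant map from a `χ`-isotypic module to a `χ'`-isotypic one vanishes: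
  «`Hom = Ext¹ = 0` between distinct characters of a commutative monoid».
* §3 (SELF-extensions, `χ' = χ`) RIGIDITY: `D_u` depends only on `p u`; `(ρ g - χ g)(ρ h - χ h) = 0`; SPLIT ⟺ `ρ g = χ g • id`
  for all `g` ⟺ the ONE-VECTOR TEST `ρ g u = χ g • u`; the scalar locus `{g | ρ g = χ g • id}` is closed under products
  (and inverses), whence the GENERATOR TEST and «split ⟺ `ρ t₀ u = χ t₀ • u`» when `G = ⟨S, t₀⟩` with `S` scalar; the
  FINITE-ORDER TEST «`(ρ g)^n = 1` with `n` a unit of `k` forces `ρ g = χ g • id`» (a torsion image acts by the scalar).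
The additive character `χ⁻¹ • D_u : G → ker p` («`Ext¹(χ, χ) = Hom(G, k)`») and the unipotent model `χ ⊗ [[1, λ],[0, 1]]`
are in the companion file `CharacterSelfExtensionModel.lean`.

SOURCES (what is formalised, read at our letters).  K. S. Brown, *Cohomology of Groups* (GTM 87), Ch. IV §2, pp. 88–89
and Prop. 2.3: the splittings of a split extension correspond to DERIVATIONS `d (gh) = dg + g·dh` («crossed homomorphisms»),
two splittings are conjugate iff the derivations differ by a PRINCIPAL one `g ↦ ga - a`, so conjugacy classes of splittings
↔ `H¹(G, A) = Der ∕ P` — read here for the `k[G]`-module extension `0 → ker p → V → k_{χ'} → 0`, where a `k`-linear section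
`1 ↦ u` is equivariant up to the derivation `D_u` of `G` into the bimodule `ker p` (left action `χ`, right action `χ'`, cf.
Brown's Remark on p. 88 «think of `G` as acting on the right as well»), principal derivations are exactly the changes of `u`,
and an EQUIVARIANT section exists iff the class of `D_u` vanishes (§1); and Ch. III §1 Exercise 2, p. 60: for TRIVIAL
coefficients the principal derivations vanish and `H¹(G, M) = Hom(G, M)` — read at `χ' = χ`, where after untwisting by `χ`
the bimodule `ker p` is trivial, `D_u` is independent of `u` and `χ⁻¹ D_u` is an additive homomorphism `G → ker p` (§3; the
abstract statement `H¹ ≃ Hom` for a trivial module is Mathlib's `groupCohomology.H1LequivOfIsTrivial` and is NOT restated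
here — this file stays in the explicit «functional `p` + vector `u`» currency its consumers hold).  §2 is the remark that a
central element acting by two different scalars whose difference is invertible splits the extension (the derivation is then
principal by the commutation identity `(χ' g₀ - χ g₀) • D g = (χ' g - χ g) • D g₀`).  Deliberately NOT here: `Ext`-groups
as objects, Baer sums, topology, and anything specific to the groups where this is applied.
-/

set_option autoImplicit false

namespace Literature.RepresentationTheory

variable {k : Type*} [CommRing k] {G : Type*} {V : Type*} [AddCommGroup V] [Module k V]

/-! ## §1 The derivation attached to a base vector -/

section Derivation

variable [Monoid G]

/-- The quotient map kills `ρ g v - χ' g • v`: every «derivation value» `D_v g := ρ g v - χ' g • v` lies in `ker p`.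
[cite: Brown1982, Ch. IV §2 pp. 88–89] -/
theorem apply_sub_smul_mem_ker (ρ : Representation k G V) (χ' : G →* k) (p : V →ₗ[k] k)
    (hquot : ∀ g v, p (ρ g v) = χ' g * p v) (g : G) (v : V) :
    p (ρ g v - χ' g • v) = 0 := by
  rw [map_sub, map_smul, hquot, smul_eq_mul, sub_self]

/-- `G` acts on every derivation value by the sub character: `ρ g (ρ h v - χ' h • v) = χ g • (ρ h v - χ' h • v)`.
[cite: Brown1982, Ch. IV §2 pp. 88–89] -/
theorem apply_apply_sub_smul (ρ : Representation k G V) (χ χ' : G →* k) (p : V →ₗ[k] k)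
    (hquot : ∀ g v, p (ρ g v) = χ' g * p v) (hker : ∀ g v, p v = 0 → ρ g v = χ g • v) (g h : G) (v : V) :
    ρ g (ρ h v - χ' h • v) = χ g • (ρ h v - χ' h • v) :=
  hker g _ (apply_sub_smul_mem_ker ρ χ' p hquot h v)

/-- **TWISTED LEIBNIZ RULE.**  The map `D_u : g ↦ ρ g u - χ' g • u` is a derivation of `G` into the `(χ, χ')`-bimodule
`ker p`: `D_u (g * h) = χ g • D_u h + χ' h • D_u g` (for ANY vector `u`).
[cite: Brown1982, Ch. IV §2 pp. 88–89 (eq. (2.2) and the Remark)] -/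
theorem derivation_mul (ρ : Representation k G V) (χ χ' : G →* k) (p : V →ₗ[k] k)
    (hquot : ∀ g v, p (ρ g v) = χ' g * p v) (hker : ∀ g v, p v = 0 → ρ g v = χ g • v) (u : V) (g h : G) :
    ρ (g * h) u - χ' (g * h) • u = χ g • (ρ h u - χ' h • u) + χ' h • (ρ g u - χ' g • u) := by
  have h1 : ρ (g * h) u = ρ g (ρ h u) := by rw [map_mul, Module.End.mul_apply]
  have h2 : ρ g (ρ h u) = ρ g (ρ h u - χ' h • u) + χ' h • ρ g u := by
    rw [map_sub, map_smul, sub_add_cancel]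
  rw [h1, h2, apply_apply_sub_smul ρ χ χ' p hquot hker, map_mul]
  module

/-- The derivation vanishes at `1`: `D_u 1 = 0`. [cite: Brown1982, Ch. IV §2 Exercise 1 p. 89] -/
theorem derivation_one (ρ : Representation k G V) (χ' : G →* k) (u : V) : ρ 1 u - χ' 1 • u = 0 := by
  rw [map_one, map_one, Module.End.one_apply, one_smul, sub_self]

/-- **CHANGE OF BASE VECTOR = PRINCIPAL DERIVATION.**  Replacing `u` by `u + w` with `w ∈ ker p` changes the derivation by
the principal derivation `g ↦ (χ g - χ' g) • w`: `D_{u+w} g = D_u g + (χ g - χ' g) • w`.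
[cite: Brown1982, Ch. IV §2 p. 89 (principal derivations)] -/
theorem derivation_add_of_mem_ker (ρ : Representation k G V) (χ χ' : G →* k) (p : V →ₗ[k] k)
    (hker : ∀ g v, p v = 0 → ρ g v = χ g • v) (u : V) {w : V} (hw : p w = 0) (g : G) :
    ρ g (u + w) - χ' g • (u + w) = (ρ g u - χ' g • u) + (χ g - χ' g) • w := by
  rw [map_add, hker g w hw]
  module

/-- **SPLIT ⟺ PRINCIPAL.**  Given a base vector `u` (`p u = 1`): an equivariant section exists — some `v₀` with `p v₀ = 1` on which
`G` acts by `χ'` — iff the derivation `D_u` is principal, `D_u g = (χ' g - χ g) • w` for a fixed `w ∈ ker p` (then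
`v₀ = u + w`). [cite: Brown1982, Ch. IV §2 pp. 88–89 and Prop. 2.3 p. 89] -/
theorem exists_fixedVector_iff_derivation_principal (ρ : Representation k G V) (χ χ' : G →* k) (p : V →ₗ[k] k)
    (hker : ∀ g v, p v = 0 → ρ g v = χ g • v) {u : V} (hu : p u = 1) :
    (∃ v₀ : V, p v₀ = 1 ∧ ∀ g, ρ g v₀ = χ' g • v₀) ↔
      ∃ w : V, p w = 0 ∧ ∀ g, ρ g u - χ' g • u = (χ' g - χ g) • w := by
  constructor
  · rintro ⟨v₀, hv₀, hfix⟩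
    have hw : p (v₀ - u) = 0 := by rw [map_sub, hv₀, hu, sub_self]
    refine ⟨v₀ - u, hw, fun g => ?_⟩
    have hu' : u = v₀ - (v₀ - u) := by abel
    have key : ρ g u = χ' g • v₀ - χ g • (v₀ - u) := by
      conv_lhs => rw [hu']
      rw [map_sub, hfix g, hker g _ hw]
    rw [key]
    module
  · rintro ⟨w, hw, hD⟩
    refine ⟨u + w, by rw [map_add, hu, hw, add_zero], fun g => ?_⟩
    have key : ρ g u = χ' g • u + (χ' g - χ g) • w := by rw [← hD g, add_sub_cancel]
    rw [map_add, key, hker g w hw]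
    module

/-- The line through a vector on which `G` acts by a character is a subrepresentation (`G`-stable submodule).
[cite: Brown1982, Ch. IV §2 Prop. 2.1 p. 87] -/
theorem span_singleton_le_comap_of_apply_eq_smul (ρ : Representation k G V) (χ' : G →* k) {v₀ : V}
    (hfix : ∀ g, ρ g v₀ = χ' g • v₀) (g : G) : (k ∙ v₀) ≤ (k ∙ v₀).comap (ρ g) := by
  intro x hx
  obtain ⟨c, rfl⟩ := Submodule.mem_span_singleton.mp hx
  rw [Submodule.mem_comap, map_smul, hfix g, smul_smul]
  exact Submodule.smul_mem _ _ (Submodule.mem_span_singleton_self v₀)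

/-- `ker p` is a subrepresentation. [cite: Brown1982, Ch. IV §2 pp. 87–88] -/
theorem ker_le_comap_of_quot (ρ : Representation k G V) (χ' : G →* k) (p : V →ₗ[k] k)
    (hquot : ∀ g v, p (ρ g v) = χ' g * p v) (g : G) : LinearMap.ker p ≤ (LinearMap.ker p).comap (ρ g) := by
  intro x hx
  rw [Submodule.mem_comap, LinearMap.mem_ker, hquot, LinearMap.mem_ker.mp hx, mul_zero]

end Derivation

/-! ## §2 Distinct characters: a commuting element acting by two different scalars splits the extension -/

section Distinct

variable [Monoid G]

/-- **COMMUTATION IDENTITY.**  For commuting `g, g₀`: `(χ' g₀ - χ g₀) • D_u g = (χ' g - χ g) • D_u g₀` (expand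
`D_u (g g₀) = D_u (g₀ g)` by the twisted Leibniz rule). [cite: Brown1982, Ch. IV §2 pp. 88–89] -/
theorem sub_smul_derivation_eq_of_commute (ρ : Representation k G V) (χ χ' : G →* k) (p : V →ₗ[k] k)
    (hquot : ∀ g v, p (ρ g v) = χ' g * p v) (hker : ∀ g v, p v = 0 → ρ g v = χ g • v) (u : V) {g g₀ : G}
    (hc : Commute g g₀) :
    (χ' g₀ - χ g₀) • (ρ g u - χ' g • u) = (χ' g - χ g) • (ρ g₀ u - χ' g₀ • u) := by
  have h1 := derivation_mul ρ χ χ' p hquot hker u g g₀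
  have h2 := derivation_mul ρ χ χ' p hquot hker u g₀ g
  rw [← hc.eq, h1] at h2
  -- h2 : χ g • D g₀ + χ' g₀ • D g = χ g₀ • D g + χ' g • D g₀
  rw [sub_smul, sub_smul, sub_eq_sub_iff_add_eq_add]
  rw [add_comm] at h2
  rw [h2, add_comm]

/-- **DISTINCT CHARACTERS SPLIT** («`Ext¹ = 0`»).  If some `g₀` commuting with every element of `G` (e.g. any element of a
commutative `G`) has `χ' g₀ - χ g₀` a unit of `k`, the extension splits: there is `v₀` with `p v₀ = 1` on which `G` acts by
`χ'` — namely `v₀ = u + (χ' g₀ - χ g₀)⁻¹ • D_u g₀`. [cite: Brown1982, Ch. IV §2 pp. 88–89 and Prop. 2.3 p. 89] -/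
theorem exists_fixedVector_of_isUnit_sub (ρ : Representation k G V) (χ χ' : G →* k) (p : V →ₗ[k] k)
    (hquot : ∀ g v, p (ρ g v) = χ' g * p v) (hker : ∀ g v, p v = 0 → ρ g v = χ g • v) {u : V} (hu : p u = 1)
    {g₀ : G} (hcomm : ∀ g, Commute g g₀) (hunit : IsUnit (χ' g₀ - χ g₀)) :
    ∃ v₀ : V, p v₀ = 1 ∧ ∀ g, ρ g v₀ = χ' g • v₀ := by
  rw [exists_fixedVector_iff_derivation_principal ρ χ χ' p hker hu]
  refine ⟨((hunit.unit⁻¹ : kˣ) : k) • (ρ g₀ u - χ' g₀ • u), ?_, fun g => ?_⟩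
  · rw [map_smul, apply_sub_smul_mem_ker ρ χ' p hquot, smul_zero]
  · rw [smul_smul, mul_comm, ← smul_smul, ← sub_smul_derivation_eq_of_commute ρ χ χ' p hquot hker u (hcomm g),
      smul_smul, IsUnit.val_inv_mul, one_smul]

/-- **NO INTERTWINERS BETWEEN DISTINCT CHARACTERS** («`Hom = 0`»).  If `G` acts on `V` through `χ` and on `W` through `χ'`
(scalar actions `A g = χ g • id`, `B g = χ' g • id`) and `χ' g₀ - χ g₀` is a unit for some `g₀`, then every `k`-linear
`f : V → W` with `f ∘ A g₀ = B g₀ ∘ f` is zero. [cite: Brown1982, Ch. III §1 p. 60] -/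
theorem eq_zero_of_intertwines_distinct_scalars {W : Type*} [AddCommGroup W] [Module k W] (χ χ' : G →* k)
    (f : V →ₗ[k] W) {g₀ : G} (hunit : IsUnit (χ' g₀ - χ g₀)) (hf : ∀ v, f (χ g₀ • v) = χ' g₀ • f v) : f = 0 := by
  ext v
  have h : (χ' g₀ - χ g₀) • f v = 0 := by rw [sub_smul, ← hf, map_smul, sub_self]
  have := congrArg (fun x => ((hunit.unit⁻¹ : kˣ) : k) • x) h
  simpa only [smul_smul, IsUnit.val_inv_mul, one_smul, smul_zero, LinearMap.zero_apply] using this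

end Distinct

/-! ## §3 Self-extensions (`χ' = χ`): rigidity, the scalar test, generators, finite order -/

section SelfExtension

variable [Monoid G]

/-- **RIGIDITY.**  For a self-extension the derivation `D_u g = ρ g u - χ g • u` depends only on `p u`: principal
derivations vanish when the sub and quotient characters agree. [cite: Brown1982, Ch. III §1 Exercise 2 p. 60] -/
theorem derivation_eq_of_apply_eq (ρ : Representation k G V) (χ : G →* k) (p : V →ₗ[k] k)
    (hker : ∀ g v, p v = 0 → ρ g v = χ g • v) {u u' : V} (huu' : p u = p u') (g : G) :
    ρ g u - χ g • u = ρ g u' - χ g • u' := by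
  have hw : p (u' - u) = 0 := by rw [map_sub, huu', sub_self]
  have h := derivation_add_of_mem_ker ρ χ χ p hker u hw g
  rwa [add_sub_cancel, sub_self, zero_smul, add_zero, eq_comm] at h

/-- **SQUARE-ZERO.**  In a self-extension `(ρ g - χ g) ∘ (ρ h - χ h) = 0`: `ρ h - χ h` maps `V` into `ker p`, where
`ρ g - χ g` vanishes. [cite: Brown1982, Ch. III §1 Exercise 2 p. 60] -/
theorem sub_smul_one_mul_sub_smul_one_eq_zero (ρ : Representation k G V) (χ : G →* k) (p : V →ₗ[k] k)
    (hquot : ∀ g v, p (ρ g v) = χ g * p v) (hker : ∀ g v, p v = 0 → ρ g v = χ g • v) (g h : G) :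
    (ρ g - χ g • (1 : Module.End k V)) * (ρ h - χ h • (1 : Module.End k V)) = 0 := by
  ext v
  have h1 : (ρ h - χ h • (1 : Module.End k V)) v = ρ h v - χ h • v := rfl
  rw [Module.End.mul_apply, h1, LinearMap.sub_apply, LinearMap.smul_apply, Module.End.one_apply,
    apply_apply_sub_smul ρ χ χ p hquot hker, sub_self, LinearMap.zero_apply]

/-- A self-extension on which `G` acts by the scalar `χ g` on `ker p` AND on one base vector `u` (`p u = 1`) acts by the scalar
on all of `V = ker p + k u`. [cite: Brown1982, Ch. III §1 Exercise 2 p. 60] -/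
theorem apply_eq_smul_of_apply_base_eq_smul (ρ : Representation k G V) (χ : G →* k) (p : V →ₗ[k] k)
    (hker : ∀ g v, p v = 0 → ρ g v = χ g • v) {u : V} (hu : p u = 1) {g : G} (hg : ρ g u = χ g • u) (v : V) :
    ρ g v = χ g • v := by
  have hw : p (v - p v • u) = 0 := by rw [map_sub, map_smul, hu, smul_eq_mul, mul_one, sub_self]
  have hv : v = (v - p v • u) + p v • u := by abel
  rw [hv, map_add, map_smul, hker g _ hw, hg]
  module

/-- **SPLIT ⟺ SCALAR ⟺ ONE-VECTOR TEST.**  For a self-extension with base vector `u` (`p u = 1`) the following are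
equivalent: (i) an equivariant section exists (some `v₀`, `p v₀ = 1`, `ρ g v₀ = χ g • v₀` for all `g`); (ii) every `ρ g` is
the scalar `χ g`; (iii) `ρ g u = χ g • u` for all `g`.  Stated as (i) ↔ (ii) here and (ii) ↔ (iii) next.
[cite: Brown1982, Ch. III §1 Exercise 2 p. 60; Ch. IV §2 Prop. 2.3 p. 89] -/
theorem exists_fixedVector_iff_forall_eq_smul_one (ρ : Representation k G V) (χ : G →* k) (p : V →ₗ[k] k)
    (hker : ∀ g v, p v = 0 → ρ g v = χ g • v) {u : V} (hu : p u = 1) :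
    (∃ v₀ : V, p v₀ = 1 ∧ ∀ g, ρ g v₀ = χ g • v₀) ↔ ∀ g, ρ g = χ g • (1 : Module.End k V) := by
  constructor
  · rintro ⟨v₀, hv₀, hfix⟩ g
    ext v
    rw [LinearMap.smul_apply, Module.End.one_apply]
    exact apply_eq_smul_of_apply_base_eq_smul ρ χ p hker hv₀ (hfix g) v
  · intro h
    exact ⟨u, hu, fun g => by rw [h g, LinearMap.smul_apply, Module.End.one_apply]⟩

/-- (ii) ↔ (iii) of the scalar test: `ρ g = χ g • id` for all `g` iff `ρ g u = χ g • u` for all `g`, `u` a base vector.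
[cite: Brown1982, Ch. III §1 Exercise 2 p. 60] -/
theorem forall_eq_smul_one_iff_forall_apply_base (ρ : Representation k G V) (χ : G →* k) (p : V →ₗ[k] k)
    (hker : ∀ g v, p v = 0 → ρ g v = χ g • v) {u : V} (hu : p u = 1) :
    (∀ g, ρ g = χ g • (1 : Module.End k V)) ↔ ∀ g, ρ g u = χ g • u := by
  refine ⟨fun h g => by rw [h g, LinearMap.smul_apply, Module.End.one_apply], fun h g => ?_⟩
  ext v
  rw [LinearMap.smul_apply, Module.End.one_apply]
  exact apply_eq_smul_of_apply_base_eq_smul ρ χ p hker hu (h g) v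

/-- **THE SCALAR LOCUS IS MULTIPLICATIVELY CLOSED.**  If `ρ g = χ g • id` and `ρ h = χ h • id` then `ρ (g h) = χ (g h) • id`
(for any representation and character; with `ρ 1 = χ 1 • id` trivially). [cite: Brown1982, Ch. III §1 p. 60] -/
theorem eq_smul_one_mul (ρ : Representation k G V) (χ : G →* k) {g h : G}
    (hg : ρ g = χ g • (1 : Module.End k V)) (hh : ρ h = χ h • (1 : Module.End k V)) :
    ρ (g * h) = χ (g * h) • (1 : Module.End k V) := by
  rw [map_mul, map_mul, hg, hh, smul_mul_smul_comm, mul_one]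

/-- `ρ 1 = χ 1 • id`. [cite: Brown1982, Ch. III §1 p. 60] -/
theorem eq_smul_one_one (ρ : Representation k G V) (χ : G →* k) : ρ 1 = χ 1 • (1 : Module.End k V) := by
  rw [map_one, map_one, one_smul]

/-- **GENERATOR TEST (monoids).**  If `ρ s = χ s • id` for every `s` in a generating set `S` of the monoid `G`
(`Submonoid.closure S = ⊤`), then `ρ g = χ g • id` for every `g` — so a self-extension is split as soon as the generators act
by scalars (scalar test). [cite: Brown1982, Ch. III §1 Exercise 2 p. 60] -/
theorem forall_eq_smul_one_of_closure_eq_top (ρ : Representation k G V) (χ : G →* k) {S : Set G}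
    (hS : Submonoid.closure S = ⊤) (h : ∀ s ∈ S, ρ s = χ s • (1 : Module.End k V)) (g : G) :
    ρ g = χ g • (1 : Module.End k V) := by
  have hg : g ∈ Submonoid.closure S := by rw [hS]; exact Submonoid.mem_top g
  induction hg using Submonoid.closure_induction with
  | mem x hx => exact h x hx
  | one => exact eq_smul_one_one ρ χ
  | mul x y _ _ hx hy => exact eq_smul_one_mul ρ χ hx hy

end SelfExtension

section SelfExtensionGroup

variable [Group G]

/-- The scalar locus is closed under inverses (groups): `ρ g = χ g • id ⇒ ρ g⁻¹ = χ g⁻¹ • id`.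
[cite: Brown1982, Ch. III §1 p. 60] -/
theorem eq_smul_one_inv (ρ : Representation k G V) (χ : G →* k) {g : G}
    (hg : ρ g = χ g • (1 : Module.End k V)) : ρ g⁻¹ = χ g⁻¹ • (1 : Module.End k V) := by
  have h1 : ρ g⁻¹ * ρ g = 1 := by rw [← map_mul, inv_mul_cancel, map_one]
  have h2 : χ g⁻¹ * χ g = 1 := by rw [← map_mul, inv_mul_cancel, map_one]
  rw [hg, mul_smul_comm, mul_one] at h1
  have h3 := congrArg (fun x : Module.End k V => χ g⁻¹ • x) h1
  simpa only [smul_smul, h2, one_smul] using h3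

/-- **GENERATOR TEST (groups).**  If `ρ s = χ s • id` for every `s` in a set `S` generating the GROUP `G`
(`Subgroup.closure S = ⊤`), then `ρ g = χ g • id` for all `g`.  Typical use: `G = T` a torus generated by a compact subgroup
`T_c` (handled by the finite-order test) and ONE further element `t₀`, so that a self-extension of `χ` splits iff
`ρ t₀ u = χ t₀ • u` for one base vector `u`. [cite: Brown1982, Ch. III §1 Exercise 2 p. 60] -/
theorem forall_eq_smul_one_of_subgroupClosure_eq_top (ρ : Representation k G V) (χ : G →* k) {S : Set G}
    (hS : Subgroup.closure S = ⊤) (h : ∀ s ∈ S, ρ s = χ s • (1 : Module.End k V)) (g : G) :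
    ρ g = χ g • (1 : Module.End k V) := by
  have hg : g ∈ Subgroup.closure S := by rw [hS]; exact Subgroup.mem_top g
  induction hg using Subgroup.closure_induction with
  | mem x hx => exact h x hx
  | one => exact eq_smul_one_one ρ χ
  | mul x y _ _ hx hy => exact eq_smul_one_mul ρ χ hx hy
  | inv x _ hx => exact eq_smul_one_inv ρ χ hx

/-- **SPLIT ⟺ ONE-ELEMENT TEST.**  If the group `G` is generated by a set `S` on which `ρ` already acts by the scalars `χ s`
(e.g. a compact subgroup acting through a finite quotient, see the finite-order test) together with ONE element `t₀`, then a
self-extension of `χ` with base vector `u` splits iff `ρ t₀ u = χ t₀ • u`.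
[cite: Brown1982, Ch. III §1 Exercise 2 p. 60; Ch. IV §2 Prop. 2.3 p. 89] -/
theorem exists_fixedVector_iff_apply_base_of_closure_insert (ρ : Representation k G V) (χ : G →* k) (p : V →ₗ[k] k)
    (hker : ∀ g v, p v = 0 → ρ g v = χ g • v) {u : V} (hu : p u = 1) {S : Set G} {t₀ : G}
    (hS : Subgroup.closure (insert t₀ S) = ⊤) (hscal : ∀ s ∈ S, ρ s = χ s • (1 : Module.End k V)) :
    (∃ v₀ : V, p v₀ = 1 ∧ ∀ g, ρ g v₀ = χ g • v₀) ↔ ρ t₀ u = χ t₀ • u := by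
  rw [exists_fixedVector_iff_forall_eq_smul_one ρ χ p hker hu]
  refine ⟨fun h => by rw [h t₀, LinearMap.smul_apply, Module.End.one_apply], fun h => ?_⟩
  have ht₀ : ρ t₀ = χ t₀ • (1 : Module.End k V) := by
    ext v
    rw [LinearMap.smul_apply, Module.End.one_apply]
    exact apply_eq_smul_of_apply_base_eq_smul ρ χ p hker hu h v
  refine forall_eq_smul_one_of_subgroupClosure_eq_top ρ χ hS (fun s hs => ?_)
  rcases Set.mem_insert_iff.mp hs with rfl | hs'
  · exact ht₀
  · exact hscal s hs'

end SelfExtensionGroup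

section FiniteOrder

variable [Monoid G]

/-- Powers in a self-extension: `χ g • (ρ g)^m u = (χ g)^(m+1) • u + (m (χ g)^m) • D_u g` — the binomial formula for
`(χ g + N)^m` with `N = ρ g - χ g`, `N² = 0` (multiplied once by `χ g` to avoid the exponent `m - 1`).
[cite: Brown1982, Ch. III §1 Exercise 2 p. 60] -/
theorem smul_pow_apply_base_eq (ρ : Representation k G V) (χ : G →* k) (p : V →ₗ[k] k)
    (hquot : ∀ g v, p (ρ g v) = χ g * p v) (hker : ∀ g v, p v = 0 → ρ g v = χ g • v) (u : V) (g : G) (m : ℕ) :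
    χ g • ((ρ g) ^ m) u = (χ g) ^ (m + 1) • u + ((m : k) * (χ g) ^ m) • (ρ g u - χ g • u) := by
  induction m with
  | zero => simp only [pow_zero, Module.End.one_apply, zero_add, pow_one, Nat.cast_zero, zero_mul, zero_smul, add_zero]
  | succ m ih =>
    have hN : ρ g (ρ g u - χ g • u) = χ g • (ρ g u - χ g • u) := apply_apply_sub_smul ρ χ χ p hquot hker g g u
    have step : χ g • ((ρ g) ^ (m + 1)) u = ρ g (χ g • ((ρ g) ^ m) u) := by
      rw [pow_succ', Module.End.mul_apply, map_smul]
    rw [step, ih, map_add, map_smul, map_smul, hN, Nat.cast_succ]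
    have hu : ρ g u = (ρ g u - χ g • u) + χ g • u := by abel
    rw [hu]
    simp only [smul_add, smul_smul, pow_succ]
    module

/-- **FINITE-ORDER TEST.**  If `(ρ g)^n = 1` for some `n ≥ 1` whose image in `k` is a unit (e.g. `k` a field of
characteristic `0`), then `ρ g` acts on a self-extension of `χ` by the scalar `χ g`: a torsion image cannot carry the
non-trivial unipotent `[[1, λ],[0, 1]]`, `λ ≠ 0`.  («A compact subgroup acting through a finite quotient acts on a
self-extension of `χ` by `χ`.») [cite: Brown1982, Ch. III §1 Exercise 2 p. 60] -/
theorem apply_base_eq_smul_of_pow_eq_one (ρ : Representation k G V) (χ : G →* k) (p : V →ₗ[k] k)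
    (hquot : ∀ g v, p (ρ g v) = χ g * p v) (hker : ∀ g v, p v = 0 → ρ g v = χ g • v) {u : V} (hu : p u = 1)
    {g : G} {n : ℕ} (hpow : (ρ g) ^ n = 1) (hnk : IsUnit ((n : k))) :
    ρ g u = χ g • u := by
  -- `(χ g)^n = 1`: apply `p` to `(ρ g)^n u = u`, using `(ρ g)^n = ρ (g^n)`.
  have hχn : (χ g) ^ n = 1 := by
    have h1 : p (((ρ g) ^ n) u) = (χ g) ^ n := by
      rw [← map_pow, hquot, ← map_pow, hu, mul_one]
    rw [← h1, hpow, Module.End.one_apply, hu]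
  -- the binomial identity at `m = n`
  have h := smul_pow_apply_base_eq ρ χ p hquot hker u g n
  rw [hpow, Module.End.one_apply, pow_succ, hχn, one_mul] at h
  -- h : χ g • u = χ g • u + (n * 1) • D   ⇒  n • D = 0  ⇒  D = 0
  have hD : ((n : k) * 1) • (ρ g u - χ g • u) = 0 := by
    have := congrArg (fun x => x - χ g • u) h
    simpa only [add_sub_cancel_left, sub_self] using this.symm
  rw [mul_one] at hD
  have := congrArg (fun x => ((hnk.unit⁻¹ : kˣ) : k) • x) hD
  simp only [smul_smul, IsUnit.val_inv_mul, one_smul, smul_zero] at this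
  exact sub_eq_zero.mp this

/-- Finite-order test, operator form: `(ρ g)^n = 1`, `n ≥ 1` a unit in `k` ⇒ `ρ g = χ g • id` on a self-extension of `χ`.
[cite: Brown1982, Ch. III §1 Exercise 2 p. 60] -/
theorem eq_smul_one_of_pow_eq_one (ρ : Representation k G V) (χ : G →* k) (p : V →ₗ[k] k)
    (hquot : ∀ g v, p (ρ g v) = χ g * p v) (hker : ∀ g v, p v = 0 → ρ g v = χ g • v) {u : V} (hu : p u = 1)
    {g : G} {n : ℕ} (hpow : (ρ g) ^ n = 1) (hnk : IsUnit ((n : k))) :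
    ρ g = χ g • (1 : Module.End k V) := by
  ext v
  rw [LinearMap.smul_apply, Module.End.one_apply]
  exact apply_eq_smul_of_apply_base_eq_smul ρ χ p hker hu
    (apply_base_eq_smul_of_pow_eq_one ρ χ p hquot hker hu hpow hnk) v

end FiniteOrder

end Literature.RepresentationTheory
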